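/-
Copyright (c) 2026. All rights reserved.
Released under Apache 2.0 license as described in the file LICENSE.
Authors: abc-iut cell, wave-4 seat abc-iut-w4-d059 (proof-only; piece (P-A′-E), second half: translated
standard vertices, and "fixing a branch class fixes the opposite branch class and its vertex").
-/
import Literature.AnabelianGeometry.SemiGraphs.SubgroupPresentationArithStabilizers
import Literature.AnabelianGeometry.SemiGraphs.SubdivisionPaths
import HarnessLib

/-!
# [SemiAnbd] Thm 5.4 (i) p. 66: arithmetic stabilisers of level vertices and branches, second half
# (proof-only)

Mochizuki, *Semi-graphs of anabelioids*, Publ. RIMS **42** (2006), §5 p. 65 / Thm 5.4 (i) p. 66; "the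
arithmetic actions on the underlying graphs … do not switch the branches of any edge" (Thm 5.4, p. 66).
[cite: MochizukiSemiAnbd2006, Thm 5.4 (i) p.66]

PROOF-ONLY sequel to `SubgroupPresentationArithStabilizers.lean` (abc-iut cell, producer row T54-B, piece
(P-A′-E) of the (AI4″) producer, seat abc-iut-w4-d059), in abc-iut-L3-d4's T1c currency:

* `exists_mul_inner_isVConj_one_of_fixes_vMk'` — the vertex dictionary at a TRANSLATED standard vertex
  `H_w · y · N`: if `e` fixes it then `σ_e w = w` and `ι(y) e ι(y)⁻¹ ι(n)` normalises `H_w` through `Φ` for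
  some `n ∈ N` (reduction to `y = 1` along the deck translation by `y`);
* `aut_branchMap_eq_self_of_same_edge` / `arithAct_fixes_opposite_vertex` — an automorphism fixing a
  branch fixes every branch of the same edge (no hypothesis: the other branch has nowhere else to go), hence
  an element fixing a branch class `(b, M_ε z N)` fixes the vertex class the opposite branch abuts to.
  With these, the pair dictionary "`Stab(vertex, branch)`" is controlled by the TWO end-vertex
  dictionaries (route (E-B′): no two-sided branch normalisation is needed);
* `exists_conj_s_mem_M_of_fixes_bMk` — (E-B″) an element normalising `H_{v₀}` through `Φ` and fixing the
  standard branch class at EVERY level maps the branch group `s_{b₀} M_ε s_{b₀}⁻¹` into itself (apply to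
  `v` and `v⁻¹` for equality) — the input `hκE'` of `map_aug_le_conj_of_levelDict'`, modulo the
  separation of `H_{v₀}` by the levels.

No definition; nothing here takes a side on [IUTchIII] Cor. 3.12; typed ≠ proved elsewhere.
-/

namespace Literature.AnabelianGeometry.SemiGraphs

namespace SemiGraph

namespace SubgroupPresentation

open CategoryTheory

universe u v

variable {𝔾 : SemiGraph.{u}} {Γ : Type u} [Group Γ] (P : SubgroupPresentation 𝔾 Γ)
  {E : Type v} [Group E] {Φ : E →* MulAut Γ} {σ : E →* Aut 𝔾} (hP : P.IsArithCompatible Φ σ)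
  (N : Subgroup Γ) [N.Normal] (hN : ∀ (e : E) (x : Γ), x ∈ N → Φ e x ∈ N)
  (ι : Γ →* E) (hιΦ : ∀ g : Γ, Φ (ι g) = MulAut.conj g) (hισ : ∀ g : Γ, σ (ι g) = 1)

include hιΦ hισ in
/-- **The vertex dictionary at a translated standard vertex**: if `e` fixes the class `H_w · y · N` then
`σ_e w = w` and, for some `n ∈ N`, the element `ι(y) · e · ι(y)⁻¹ · ι(n)` normalises `H_w` through `Φ`
(vertex conjugator `1`). [cite: MochizukiSemiAnbd2006, Thm 5.4 (i) p.66] -/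
theorem exists_mul_inner_isVConj_one_of_fixes_vMk' (w : 𝔾.Vertex) (y : Γ) (e : E)
    (hfix : (P.arithAct hP N hN e).hom.vertexMap (P.vMk N w y) = P.vMk N w y) :
    (σ e).hom.vertexMap w = w ∧ ∃ n ∈ N, P.IsVConj Φ σ (ι y * e * (ι y)⁻¹ * ι n) w 1 := by
  -- `ι(y) e ι(y)⁻¹` fixes the standard vertex `H_w · 1 · N`
  have hfix' : (P.arithAct hP N hN (ι y * e * (ι y)⁻¹)).hom.vertexMap (P.vMk N w 1) = P.vMk N w 1 := by
    rw [map_mul, map_mul, aut_mul_vertexMap, aut_mul_vertexMap, ← map_inv,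
      P.arithAct_eq_deckAct_of_inner hP N hN (hιΦ y⁻¹) (hισ y⁻¹), P.deckAct_vertexMap_vMk, inv_inv,
      one_mul, hfix, P.arithAct_eq_deckAct_of_inner hP N hN (hιΦ y) (hισ y), P.deckAct_vertexMap_vMk,
      mul_inv_cancel]
  obtain ⟨hσ, n, hn, hV⟩ :=
    P.exists_mul_inner_isVConj_one_of_fixes_vMk hP N hN ι hιΦ hισ w (ι y * e * (ι y)⁻¹) hfix'
  refine ⟨?_, n, hn, hV⟩
  rw [map_mul, map_mul, ← map_inv, hισ, hισ, mul_one, one_mul] at hσ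
  exact hσ

omit hP hN hιΦ hισ in
/-- **Fixing a branch fixes the opposite branch** (any automorphism of any semi-graph): if `F` fixes the
branch `β`, then it fixes every branch `β'` of the same edge — `F β'` is a branch of `F(e) = e` different
from `F β = β`. [cite: MochizukiSemiAnbd2006, §1 p.11] -/
theorem aut_branchMap_eq_self_of_same_edge {G : SemiGraph.{u}} (F : Aut G) {β β' : G.Branch}
    (he : G.edgeOf β' = G.edgeOf β) (hfix : F.hom.branchMap β = β) : F.hom.branchMap β' = β' := by
  by_cases hββ : β' = β
  · rw [hββ, hfix]
  · have hedge : F.hom.edgeMap (G.edgeOf β) = G.edgeOf β := by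
      rw [← F.hom.edgeOf_branchMap, hfix]
    have h1 : G.edgeOf (F.hom.branchMap β') = G.edgeOf β := by
      rw [F.hom.edgeOf_branchMap, he, hedge]
    have h2 : F.hom.branchMap β' ≠ β := by
      intro h
      rw [← hfix] at h
      exact hββ (aut_branchMap_injective F h)
    exact SemiGraph.branch_eq_of_ne_of_ne rfl h1 he h2 hββ

omit [N.Normal] hιΦ hισ in
/-- **Fixing a branch class fixes the vertex class the OPPOSITE branch abuts to** (level `N` coset graph,
arithmetic action): for the branch classes `(b, M_ε z N)`, `(b', M_ε z N)` of one edge class with `b'`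
abutting to `w'`, an element fixing the first fixes `H_{w'} · s_{b'} z · N`.
[cite: MochizukiSemiAnbd2006, Thm 5.4 (i) p.66] -/
theorem arithAct_fixes_opposite_vertex {b b' : 𝔾.Branch} (hbb : 𝔾.edgeOf b' = 𝔾.edgeOf b)
    {w' : 𝔾.Vertex} (hw' : 𝔾.abuts b' = some w') (z : Γ) (e : E)
    (hfix : (P.arithAct hP N hN e).hom.branchMap (P.bMk N b z) = P.bMk N b z) :
    (P.arithAct hP N hN e).hom.vertexMap (P.vMk N w' (P.s b' * z)) = P.vMk N w' (P.s b' * z) := by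
  have hbr : (P.arithAct hP N hN e).hom.branchMap (P.bMk N b' z) = P.bMk N b' z :=
    aut_branchMap_eq_self_of_same_edge (P.arithAct hP N hN e)
      (show (P.cosetGraph N).edgeOf (P.bMk N b' z) = (P.cosetGraph N).edgeOf (P.bMk N b z) from
        congrArg (fun ε => (⟨ε, DoubleCoset.mk (P.M ε) N z⟩ : (P.cosetGraph N).Edge)) hbb) hfix
  have := (P.arithAct hP N hN e).hom.abuts_branchMap (P.bMk N b' z) (P.vMk N w' (P.s b' * z))
    (P.cosetGraph_abuts_bMk N b' w' hw' z)
  rw [hbr, P.cosetGraph_abuts_bMk N b' w' hw' z] at this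
  exact (Option.some.inj this).symm

/-! ### (E-B″) An element of the pro-vertex normaliser fixing the standard branch class at every level
normalises the branch group -/

omit [N.Normal] hN in
/-- **(E-B″) Fixing the standard branch class at EVERY level normalises the branch group** (one-sided;
apply it to `v` and `v⁻¹` for the two-sided statement): let `v ∈ E` normalise `H_{v₀}` through `Φ` (vertex
conjugator `1`) and fix the standard branch class `(b₀, M_ε s_{b₀}⁻¹ N_n)` under the arithmetic action at
every level `N_n` of a family of `Φ`-stable normal levels; if the only elements of `H_{v₀}` lying in
`s_{b₀} M_ε s_{b₀}⁻¹ · N_n` for every `n` are those of `s_{b₀} M_ε s_{b₀}⁻¹` (the levels separate `H_{v₀}`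
modulo the branch group — the dischargeable topological input, cf. `hHK`/`hMK`), then
`Φ_v(s_{b₀} M_ε s_{b₀}⁻¹) ⊆ s_{b₀} M_ε s_{b₀}⁻¹`.  (With an edge conjugator `m`: the branch clause of
`IsEConj` and self-normalisation put `c := s m⁻¹ Φ_v(s)⁻¹` in `H_{v₀}`; the fixed classes put `c` in
`s M s⁻¹ N_n` for every `n`; so `c ∈ s M s⁻¹`, and `Φ_v(s x s⁻¹) = c⁻¹ (s x' s⁻¹) c` with
`x' = m⁻¹ Φ_v(x) m ∈ M`.) [cite: MochizukiSemiAnbd2006, Thm 5.4 (i) p.66] -/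
theorem exists_conj_s_mem_M_of_fixes_bMk {ιN : Type*} [Nonempty ιN] (Ns : ιN → Subgroup Γ)
    (hNs : ∀ (n : ιN) (e : E) (x : Γ), x ∈ Ns n → Φ e x ∈ Ns n)
    {v₀ : 𝔾.Vertex} {b₀ : 𝔾.Branch} (hb₀ : 𝔾.abuts b₀ = some v₀) (v : E) (hV : P.IsVConj Φ σ v v₀ 1)
    (hfix : ∀ n, (P.arithAct hP (Ns n) (hNs n) v).hom.branchMap (P.bMk (Ns n) b₀ (P.s b₀)⁻¹) =
      P.bMk (Ns n) b₀ (P.s b₀)⁻¹)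
    (hsep : ∀ c ∈ P.H v₀, (∀ n, ∃ μ ∈ P.M (𝔾.edgeOf b₀), ∃ y ∈ Ns n,
      c = P.s b₀ * μ * (P.s b₀)⁻¹ * y) → ∃ μ ∈ P.M (𝔾.edgeOf b₀), c = P.s b₀ * μ * (P.s b₀)⁻¹)
    (x : Γ) (hx : x ∈ P.M (𝔾.edgeOf b₀)) :
    ∃ x' ∈ P.M (𝔾.edgeOf b₀), Φ v (P.s b₀ * x * (P.s b₀)⁻¹) = P.s b₀ * x' * (P.s b₀)⁻¹ := by
  obtain ⟨n₀⟩ := ‹Nonempty ιN›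
  set s := P.s b₀ with hs_def
  set m := P.eConj hP v (𝔾.edgeOf b₀) with hm_def
  have hm : P.IsEConj Φ σ v (𝔾.edgeOf b₀) m := P.isEConj_eConj hP v (𝔾.edgeOf b₀)
  -- the fixed class at a level, unpacked: `σ_v b₀ = b₀` and `M (m⁻¹ Φ_v s⁻¹) N_n = M s⁻¹ N_n`
  have hlev : ∀ n, (σ v).hom.branchMap b₀ = b₀ ∧
      DoubleCoset.mk (P.M (𝔾.edgeOf b₀)) (Ns n) (m⁻¹ * Φ v s⁻¹) =
        DoubleCoset.mk (P.M (𝔾.edgeOf b₀)) (Ns n) s⁻¹ := by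
    intro n
    have h := hfix n
    change (P.arithHom hP (Ns n) (hNs n) v).branchMap _ = _ at h
    rw [P.arithHom_branchMap_bMk hP (Ns n) (hNs n) hm] at h
    have hb : (σ v).hom.branchMap b₀ = b₀ := congrArg (fun p : (P.cosetGraph (Ns n)).Branch => p.1.1) h
    refine ⟨hb, ?_⟩
    have he : (σ v).hom.edgeMap (𝔾.edgeOf b₀) = 𝔾.edgeOf b₀ := by
      rw [← (σ v).hom.edgeOf_branchMap, hb]
    have h2 := congrArg (fun p : (P.cosetGraph (Ns n)).Branch => p.1.2) h
    simp only at h2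
    rw [(σ v).hom.edgeOf_branchMap, he] at h2
    exact eq_of_heq (Sigma.mk.inj_iff.mp h2).2
  have hσb : (σ v).hom.branchMap b₀ = b₀ := (hlev n₀).1
  have hσe : (σ v).hom.edgeMap (𝔾.edgeOf b₀) = 𝔾.edgeOf b₀ := by
    rw [← (σ v).hom.edgeOf_branchMap, hσb]
  have hσv : (σ v).hom.vertexMap v₀ = v₀ := by
    have := (σ v).hom.abuts_branchMap b₀ v₀ hb₀
    rw [hσb, hb₀] at this
    exact (Option.some.inj this).symm
  -- the branch clause of `IsEConj` at `b₀`: `c := s m⁻¹ Φ_v(s)⁻¹ ∈ H_{v₀}` (self-normalisation: `k ∈ H`)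
  obtain ⟨k, hk, hkmem⟩ := hm.2 b₀ v₀ rfl hb₀
  rw [hσb, hσv] at hkmem
  have hk1 : k ∈ P.H v₀ := by
    have := IsVConj.inv_mul_mem hP hV hk
    rw [hσv, inv_one, one_mul] at this
    exact this
  have hc : s * m⁻¹ * (Φ v s)⁻¹ ∈ P.H v₀ := by
    have := (P.H v₀).mul_mem hkmem ((P.H v₀).inv_mem hk1)
    rwa [mul_inv_cancel_right] at this
  -- `c ∈ s M s⁻¹ N_n` for every `n`
  have hcN : ∀ n, ∃ μ ∈ P.M (𝔾.edgeOf b₀), ∃ y ∈ Ns n, s * m⁻¹ * (Φ v s)⁻¹ = s * μ * s⁻¹ * y := by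
    intro n
    obtain ⟨μ, hμ, y, hy, hcl⟩ := (DoubleCoset.eq _ _ _ _).mp (hlev n).2
    -- `hcl : s⁻¹ = μ * (m⁻¹ * Φ v s⁻¹) * y`
    refine ⟨μ⁻¹, (P.M _).inv_mem hμ, y⁻¹, (Ns n).inv_mem hy, ?_⟩
    rw [map_inv] at hcl
    calc s * m⁻¹ * (Φ v s)⁻¹ = s * (μ⁻¹ * (μ * (m⁻¹ * (Φ v s)⁻¹) * y) * y⁻¹) := by group
      _ = s * μ⁻¹ * s⁻¹ * y⁻¹ := by rw [← hcl]; group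
  obtain ⟨μ₀, hμ₀, hcμ₀⟩ := hsep _ hc hcN
  -- conclusion: `Φ_v(s x s⁻¹) = c⁻¹ (s x' s⁻¹) c` with `x' = m⁻¹ Φ_v(x) m ∈ M`
  have hx' : m⁻¹ * Φ v x * m ∈ P.M (𝔾.edgeOf b₀) := by
    have := hm.1 x hx
    rwa [hσe] at this
  refine ⟨μ₀⁻¹ * (m⁻¹ * Φ v x * m) * μ₀, (P.M _).mul_mem ((P.M _).mul_mem ((P.M _).inv_mem hμ₀) hx') hμ₀, ?_⟩
  have hΦs : Φ v s = μ₀ ⁻¹ * 1 * μ₀ * (s * μ₀ * s⁻¹)⁻¹ * s * m⁻¹ := by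
    have h := hcμ₀
    -- from `s * m⁻¹ * (Φ v s)⁻¹ = s * μ₀ * s⁻¹`
    have : (Φ v s)⁻¹ = m * s⁻¹ * (s * μ₀ * s⁻¹) := by
      calc (Φ v s)⁻¹ = m * s⁻¹ * (s * m⁻¹ * (Φ v s)⁻¹) := by group
        _ = m * s⁻¹ * (s * μ₀ * s⁻¹) := by rw [h]
    calc Φ v s = ((Φ v s)⁻¹)⁻¹ := by rw [inv_inv]
      _ = (m * s⁻¹ * (s * μ₀ * s⁻¹))⁻¹ := by rw [this]
      _ = _ := by group
  rw [map_mul, map_mul, map_inv, hΦs]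
  group

end SubgroupPresentation

end SemiGraph

end Literature.AnabelianGeometry.SemiGraphs
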